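import Mathlib
import HarnessLib
import Summits.AtomisticToContinuum.HydrodynamicLimit.Theses.JParityClosure
import Literature.Analysis.FunctionSpaces.FlatTorus

/-!
# Sketch — crux DensityCap (stmt-AtomisticToContinuum-13082), crux-ideate round 1, ideator 3

First lemmas of the idea cards `mass-budget-squeeze` and `residual-virial-absorption`,
stated over existing declarations (elaboration check only; `massSqueeze` and the two
compositions are proved).
-/

noncomputable section

namespace Summit.AtomisticToContinuum.HydrodynamicLimit.Cruxes.DensityCap.IdeatorThree

open scoped BigOperators Topology Classical MeasureTheory ENNReal
open Filter Set MeasureTheory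
open Literature.MathematicalPhysics.KineticTheory
open Literature.Analysis.FluidPDE
open Summit.AtomisticToContinuum.HydrodynamicLimit.Theses.JParityClosure

/-! ## Card `mass-budget-squeeze` -/

/-- MASS SQUEEZE (the equivalence witness). On the complement of the DensityCap event the
one-sided cap is two-sided in `L¹`: if `f ≤ g + η` pointwise on `𝕋³` and `∫ f = ∫ g`
(exact mass conservation on both sides), then `∫ |f - g| ≤ 2η`. -/
theorem massSqueeze (f g : T3 → ℝ) (η : ℝ) (hf : Integrable f) (hg : Integrable g)
    (hint : ∫ x, f x = ∫ x, g x) (hle : ∀ x, f x ≤ g x + η) :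
    ∫ x, |f x - g x| ≤ 2 * η := by
  have hpt : ∀ x, |f x - g x| = 2 * max (f x - g x) 0 - (f x - g x) := by
    intro x
    rcases le_total 0 (f x - g x) with h | h
    · rw [abs_of_nonneg h, max_eq_left h]; ring
    · rw [abs_of_nonpos h, max_eq_right h]; ring
  have hfg : Integrable (fun x => f x - g x) := hf.sub hg
  have hmax : Integrable (fun x => max (f x - g x) 0) := hfg.pos_part
  have hconst : ∫ _x : T3, η = η := by simp
  have hη0 : 0 ≤ η := by
    have h1 : ∫ x, f x ≤ ∫ x, (g x + η) :=
      integral_mono hf (hg.add (integrable_const η)) (fun x => hle x)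
    rw [integral_add hg (integrable_const η), hint] at h1
    linarith
  have hmaxle : ∀ x, max (f x - g x) 0 ≤ η := fun x => max_le (by linarith [hle x]) hη0
  have hsplit : ∫ x, |f x - g x| = 2 * (∫ x, max (f x - g x) 0) - ∫ x, (f x - g x) := by
    simp_rw [hpt]
    rw [integral_sub (hmax.const_mul 2) hfg, integral_const_mul]
  have hzero : ∫ x, (f x - g x) = 0 := by rw [integral_sub hf hg, hint, sub_self]
  have hmono : ∫ x, max (f x - g x) 0 ≤ ∫ _x : T3, η :=
    integral_mono hmax (integrable_const η) hmaxle
  rw [hsplit, hzero, sub_zero]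
  linarith

/-- GRID UPGRADE (first lemma of the line; provable now, size M). If the hydrodynamic fields
converge in probability at EVERY time `s ∈ [0, t]` (the conclusion of the band limit /
`HydrodynamicLimit` restricted to `[0,t]`), then the DensityCap event at threshold `η` has
vanishing probability, `N → ∞` at fixed `r`: finite `(s, x)`-grid of `N`-independent size
(the cone kernel is `3/(π r⁴)`-Lipschitz in `x`; in `s` the mollified density is
`3/(π r⁴)·√(2K_N)`-Lipschitz by exact energy conservation, `K_N` tight by the `χ = 1` energy
field at `s = 0`), `TendstoHydroFieldsAt` at the grid times with test functions `bx(·, x_k)`,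
continuity of `ρ`, union bound. Same quantifier tail as `DensityCap`. -/
def GridUpgrade : Prop :=
  ∀ (σ : ℝ) (a₀ θ₀ : T3 → ℝ) (u₀ : T3 → V3) (T : ℝ) (ρ θ : ℝ → T3 → ℝ) (u : ℝ → T3 → V3),
    0 < σ → IsHardSphereEulerSolution σ T ρ u θ →
    ∀ Φ : (N : ℕ) → HardSphereFlow (Torus.geometry (Fin 3)) (hsDiameter σ N) (N + 1),
    ∀ t ∈ Set.Ico 0 T,
    (∀ s ∈ Set.Icc 0 t,
      TendstoHydroFieldsAt (fun N => localGibbsLaw σ a₀ u₀ θ₀ N (Φ N)) Φ ρ u θ s) →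
    ∀ η δ : ℝ, 0 < η → 0 < δ → ∃ r₀ : ℝ, 0 < r₀ ∧ ∀ r : ℝ, 0 < r → r < r₀ →
      ∃ N₀ : ℕ, ∀ N : ℕ, N₀ ≤ N →
        let γ : Config (N + 1) (Fin 3) T3 → ℝ → Config (N + 1) (Fin 3) T3 :=
          fun z s => (Φ N).flow s z
        let bx : T3 → T3 → ℝ := fun x y => 3 / (Real.pi * r ^ 3) * max (1 - Torus.euclidDist x y / r) 0
        let ρm : Config (N + 1) (Fin 3) T3 → ℝ → T3 → ℝ :=
          fun z s x₀ => ∫ q, bx q.1 x₀ ∂(empiricalMeasure (γ z s))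
        localGibbsLaw σ a₀ u₀ θ₀ N (Φ N) {z | ∃ s ∈ Set.Icc 0 t, ∃ x : T3, ρ s x + η < ρm z s x}
          ≤ ENNReal.ofReal δ

/-- Composition 1 (pure logic): the grid upgrade turns the summit conclusion into `DensityCap`
— i.e. `DensityCap` is a COROLLARY of the hydrodynamic limit, hence closes last. -/
theorem densityCap_of_hydrodynamicLimit (hG : GridUpgrade) (hHL : _root_.HydrodynamicLimit) :
    DensityCap := by
  intro a₀ θ₀ u₀ ha hθ hu ha0 hθ0
  obtain ⟨σ₀, hσ₀, h⟩ := hHL a₀ θ₀ u₀ ha hθ hu ha0 hθ0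
  refine ⟨σ₀, hσ₀, ?_⟩
  intro σ hσ hσlt T ρ θ u hE Φ h0 t ht η δ hη hδ
  have hall : ∀ s ∈ Set.Icc 0 t,
      TendstoHydroFieldsAt (fun N => localGibbsLaw σ a₀ u₀ θ₀ N (Φ N)) Φ ρ u θ s := by
    intro s hs
    exact h σ hσ hσlt T ρ θ u hE Φ h0 s ⟨hs.1, lt_of_le_of_lt hs.2 ht.2⟩
  exact hG σ a₀ θ₀ u₀ T ρ θ u hσ hE Φ t ht hall η δ hη hδ

/-- The packing-guarded band limit, VERBATIM the consequent of `ParityInBand` (= the shared item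
HydroLimitInBand, stmt-AtomisticToContinuum-9133, of StrongClosureWeakBV / AnnealedZeroHorizon). -/
def BandLimit : Prop :=
  ∃ η₀ : ℝ, 0 < η₀ ∧ ∀ (a₀ θ₀ : T3 → ℝ) (u₀ : T3 → V3), Continuous a₀ → Continuous θ₀ →
    Continuous u₀ → (∀ x, 0 < a₀ x) → (∀ x, 0 < θ₀ x) → ∃ σ₀ : ℝ, 0 < σ₀ ∧ ∀ σ : ℝ, 0 < σ →
    σ < σ₀ → ∀ (T : ℝ) (ρ θ : ℝ → T3 → ℝ) (u : ℝ → T3 → V3), IsHardSphereEulerSolution σ T ρ u θ →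
    (∀ t ∈ Set.Ico 0 T, ∀ x, ρ t x * σ ^ 3 < η₀) →
    ∀ Φ : (N : ℕ) → HardSphereFlow (Torus.geometry (Fin 3)) (hsDiameter σ N) (N + 1),
    TendstoHydroFieldsAt (fun N => localGibbsLaw σ a₀ u₀ θ₀ N (Φ N)) Φ ρ u θ 0 →
    ∀ t ∈ Set.Ico 0 T, TendstoHydroFieldsAt (fun N => localGibbsLaw σ a₀ u₀ θ₀ N (Φ N)) Φ ρ u θ t

/-- Composition 2 (pure logic): at the ITEM level the line is non-circular — the band limit
(shared item 9133, provable by any route) + DiluteSelfConsistency (shared item 3091) + the grid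
upgrade give `DensityCap` as filed (unguarded). -/
theorem densityCap_of_bandLimit (hG : GridUpgrade) (hB : BandLimit) (hD : DiluteSelfConsistency) :
    DensityCap := by
  obtain ⟨η₀, hη₀, hIB⟩ := hB
  intro a₀ θ₀ u₀ ha hθ hu ha0 hθ0
  obtain ⟨σ₁, hσ₁, h1⟩ := hIB a₀ θ₀ u₀ ha hθ hu ha0 hθ0
  obtain ⟨σ₃, hσ₃, h3⟩ := hD η₀ hη₀ a₀ θ₀ u₀ ha hθ hu ha0 hθ0
  refine ⟨min σ₁ σ₃, lt_min hσ₁ hσ₃, ?_⟩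
  intro σ hσ hσlt T ρ θ u hE Φ h0 t ht η δ hη hδ
  have hσ1 : σ < σ₁ := lt_of_lt_of_le hσlt (min_le_left _ _)
  have hσ3 : σ < σ₃ := lt_of_lt_of_le hσlt (min_le_right _ _)
  have hguard : ∀ t ∈ Set.Ico 0 T, ∀ x, ρ t x * σ ^ 3 < η₀ := h3 σ hσ hσ3 T ρ θ u hE Φ h0
  have hall : ∀ s ∈ Set.Icc 0 t,
      TendstoHydroFieldsAt (fun N => localGibbsLaw σ a₀ u₀ θ₀ N (Φ N)) Φ ρ u θ s := by
    intro s hs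
    exact h1 σ hσ hσ1 T ρ θ u hE hguard Φ h0 s ⟨hs.1, lt_of_le_of_lt hs.2 ht.2⟩
  exact hG σ a₀ θ₀ u₀ T ρ θ u hσ hE Φ t ht hall η δ hη hδ

/-! ## Card `residual-virial-absorption` -/

/-- PACKING BOUND (role "no concentration" is free for hard cores; provable now, size S/M).
On the hard-sphere domain the `r`-mollified empirical density is bounded by `81/(π σ³)`
uniformly in `N`, `s`, `x₀` once `ε_N ≤ r < 1/8`: at most `(2r/ε + 1)³` disjoint `ε/2`-balls fit
in `B_{r+ε/2}`, the cone kernel is `≤ 3/(π r³)`, and `(N+1) ε³ = σ³`. -/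
def PackingBound : Prop :=
  ∀ (σ : ℝ) (N : ℕ), 0 < σ → ∀ z ∈ hardSphereDomain (Torus.geometry (Fin 3)) (N + 1) (hsDiameter σ N),
    ∀ r : ℝ, hsDiameter σ N ≤ r → r < 1 / 8 → ∀ x₀ : T3,
      (∫ q, 3 / (Real.pi * r ^ 3) * max (1 - Torus.euclidDist q.1 x₀ / r) 0 ∂(empiricalMeasure z))
        ≤ 81 / (Real.pi * σ ^ 3)

/-- SHELL SLAVING (first checkable lemma of the line; exact mechanics, size M). Along ONE good
hard-sphere trajectory, the time-integrated collisional virial inside a ball `B_r(x₀)`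
(`ε`-weighted sum over collisions in `(τ₁, τ₂]` of the momentum transfers of particles sitting in
the ball — the `K_N`-normalisation of the route) is controlled by quantities living at the two
time ENDPOINTS or in the SHELL `r ≤ d < 2r`: first velocity moments at `τ₁, τ₂` times `r`,
the time-integrated kinetic energy of the shell, and the shell's own collisional virial. Proof:
momentum balance (the filed EmpiricalEnskogIdentity with `b = ∂ₗψ`, `c(v) = vₗ`, summed over `l`)
tested against `∇ψ`, `ψ = φ(d(·, x₀))` radial, `φ(ρ) = ρ²/2` on `[0, r]`, `C²` cut-off on `[r, 2r]`;
the kinetic term `∑ v·∇∇ψ·v ≥ 0` on the ball is dropped, the collision term is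
`ε |Δv| n̂·∇∇ψ·n̂ = ε |Δv|` on the ball (psd momentum transfer along `n̂`). -/
def ShellSlaving : Prop :=
  ∃ C : ℝ, 0 < C ∧ ∀ (ε : ℝ) (N : ℕ), 0 < ε →
    ∀ Φ : HardSphereFlow (Torus.geometry (Fin 3)) ε N, ∀ z ∈ Φ.good,
    ∀ (x₀ : T3) (r : ℝ), ε ≤ r → r < 1 / 8 → ∀ τ₁ τ₂ : ℝ, 0 ≤ τ₁ → τ₁ < τ₂ →
      let G : Geometry (Fin 3) T3 := Torus.geometry (Fin 3)
      let γ : ℝ → Config N (Fin 3) T3 := fun s => Φ.flow s z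
      let d : T3 → ℝ := fun x => Torus.euclidDist x x₀
      let Vir : Set T3 → ℝ := fun S => ε / N *
        ∑ᶠ (s : ℝ) (_ : s ∈ collisionTimes G ε γ ∩ Set.Ioc τ₁ τ₂), ∑ i : Fin N, ∑ j : Fin N,
          (if i ≠ j ∧ ‖G.sepVec (γ s i).1 (γ s j).1‖ = ε ∧ (γ s i).1 ∈ S then
            ‖(γ s i).2 - (reflectVel (G.sepVec (γ s i).1 (γ s j).1) ((γ s i).2, (γ s j).2)).1‖
          else 0)
      let M1 : ℝ → ℝ := fun s => (N : ℝ)⁻¹ * ∑ i : Fin N, (if d (γ s i).1 < 2 * r then ‖(γ s i).2‖ else 0)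
      let KEshell : ℝ → ℝ := fun s => (N : ℝ)⁻¹ *
        ∑ i : Fin N, (if r ≤ d (γ s i).1 ∧ d (γ s i).1 < 2 * r then ‖(γ s i).2‖ ^ 2 else 0)
      Vir {x | d x < r} ≤
        C * (r * (M1 τ₁ + M1 τ₂) + (∫ s in Set.Icc τ₁ τ₂, KEshell s) + Vir {x | r ≤ d x ∧ d x < 2 * r})

end Summit.AtomisticToContinuum.HydrodynamicLimit.Cruxes.DensityCap.IdeatorThree
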